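import Summits.Ventures.Crystal3D.Theorems.StickyWulffConstantCoaxialWallLawPayerTransPlaneRowGen
import Summits.Ventures.Crystal3D.Theorems.StickyWulffConstantCoaxialWallLawPayerTransCellPlaneTwoPlateRowA
import HarnessLib

/-!
# The plane-coset translation rungs UNDER THE (A) CENSUS ROW, every version

HONEST FRAMING. Venture `Summits/Ventures/Crystal3D` (cell `crystal3d-full`), helper `--supports` the crux
`CoaxialWallLaw` of `route-Ventures-StickyWulffConstant` (REGISTERED line `WallLedgerF`).  Rung credit; F-C1 not
moved; inputs `KissingGap δ`, `KissingClassification δ` and the census row BY NAME.  cf-p1 DECISIONS (xxxviii⁗)(A)/(xliii):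
`…PayerTransPlaneRowGen` VERBATIM with the row hypothesis `LocalEndRowA ver s_F …` (`…EndRowDefsA`) and the cell
`wordNet_trans_payers_ge_plane_rowA`.

* `translate_twoSlabAdhesion_roots_rowA`, **`coaxialTwoSlabAdhesion_trans_skew_rowA`**, **`translate_twoSlabAdhesion_axis_rowA`**.
WHAT THIS IS NOT: not the census; F-C1 not moved.
-/

noncomputable section

namespace Summit.Ventures.Crystal3D.Theorems

open Summit.Ventures.Crystal3D Finset
open Literature.MathematicalPhysics.StatisticalMechanics (fccStacking contactDeficiency)
open scoped InnerProductSpace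

section Row

variable (ver : WordVersion) {δ : ℝ} (hg : KissingGap δ) (hc : KissingClassification δ)
include hg hc

open scoped Classical in
/-- **Two-plate assembly from root data UNDER THE ROW.**  A translation pair read in a lattice frame `G₀`, a family `RT`
of rising roots with τ-skew orthogonal partners, a flux floor `Φ`, and the local row for `(⟨G₀, RT⟩, ⟨G₀, −RT⟩)` with
constant `s_F > 0`: the stub's inequality at charge `√2·Φ/s_F`.  See the module docstring. -/
theorem translate_twoSlabAdhesion_roots_rowA
    (A₁ : EuclideanSpace ℝ (Fin 3) ≃ₗᵢ[ℝ] EuclideanSpace ℝ (Fin 3)) (t₁ : EuclideanSpace ℝ (Fin 3))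
    (A₂ : EuclideanSpace ℝ (Fin 3) ≃ₗᵢ[ℝ] EuclideanSpace ℝ (Fin 3)) (t₂ : EuclideanSpace ℝ (Fin 3))
    (htrans : A₁ '' fccStacking 1 (Real.sqrt (2 / 3)) = A₂ '' fccStacking 1 (Real.sqrt (2 / 3)))
    (G₀ : EuclideanSpace ℝ (Fin 3) ≃ₗᵢ[ℝ] EuclideanSpace ℝ (Fin 3))
    (hG₀ : G₀ '' fccStacking 1 (Real.sqrt (2 / 3)) = A₁ '' fccStacking 1 (Real.sqrt (2 / 3)))
    (RT : Finset (EuclideanSpace ℝ (Fin 3))) (hRT : ∀ r ∈ RT, r ∈ fccSlots ∧ 0 < (G₀ r) 2)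
    (hpart : ∀ r ∈ RT, ∃ s ∈ fccSlots, ⟪r, s⟫_ℝ = 0 ∧ ∀ z : ℤ, ⟪G₀.symm (t₂ - t₁), s⟫_ℝ ≠ (z : ℝ) / 2)
    {Φ : ℝ} (hΦ : Φ ≤ ∑ r ∈ RT, (G₀ r) 2) {sF : ℝ} (hsF : 0 < sF)
    (hrow : LocalEndRowA ver sF ⟨G₀, RT⟩ ⟨G₀, RT.image (fun r : EuclideanSpace ℝ (Fin 3) => -r)⟩) :
    ∃ C R₀ : ℝ, 1 ≤ R₀ ∧ ∀ h : ℝ, 0 ≤ h → ∀ ρ : ℝ, R₀ ≤ ρ →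
      ∀ X P₁ P₂ : Finset (EuclideanSpace ℝ (Fin 3)),
      (∀ p ∈ X, ∀ q ∈ X, p ≠ q → 1 ≤ dist p q) → P₁ ⊆ X → P₂ ⊆ X \ P₁ →
      (∀ p ∈ X, -(2 * R₀) ≤ p 2 ∧ p 2 ≤ h + 2 * R₀ ∧ p 0 ^ 2 + p 1 ^ 2 ≤ ρ ^ 2) →
      (∀ p, p ∈ P₁ ↔ (p ∈ (fun q => A₁ q + t₁) '' fccStacking 1 (Real.sqrt (2 / 3)) ∧
        -(2 * R₀) ≤ p 2 ∧ p 2 ≤ -R₀ ∧ p 0 ^ 2 + p 1 ^ 2 ≤ ρ ^ 2)) →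
      (∀ p, p ∈ P₂ ↔ (p ∈ (fun q => A₂ q + t₂) '' fccStacking 1 (Real.sqrt (2 / 3)) ∧
        h + R₀ ≤ p 2 ∧ p 2 ≤ h + 2 * R₀ ∧ p 0 ^ 2 + p 1 ^ 2 ≤ ρ ^ 2)) →
      ((((P₁ ×ˢ (X \ P₁)).filter fun pq => dist pq.1 pq.2 = 1).card : ℕ) : ℝ) +
        ((((P₂ ×ˢ ((X \ P₁) \ P₂)).filter fun pq => dist pq.1 pq.2 = 1).card : ℕ) : ℝ) ≤
        contactDeficiency ((X \ P₁) \ P₂) +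
          (Real.sqrt 2 / 4 * ∑ᶠ w ∈ {w ∈ fccStacking 1 (Real.sqrt (2 / 3)) | ‖w‖ = 1},
              |⟪w, A₁.symm (EuclideanSpace.single (2 : Fin 3) (1 : ℝ))⟫_ℝ| +
            Real.sqrt 2 / 4 * ∑ᶠ w ∈ {w ∈ fccStacking 1 (Real.sqrt (2 / 3)) | ‖w‖ = 1},
              |⟪w, A₂.symm (EuclideanSpace.single (2 : Fin 3) (1 : ℝ))⟫_ℝ| -
            Real.sqrt 2 * Φ / sF) * Real.pi * ρ ^ 2 +
          C * (1 + h) * ρ := by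
  -- both grains in the frame `G₀`
  have himg : ∀ (B : EuclideanSpace ℝ (Fin 3) ≃ₗᵢ[ℝ] EuclideanSpace ℝ (Fin 3)) (t : EuclideanSpace ℝ (Fin 3)),
      B '' fccStacking 1 (Real.sqrt (2 / 3)) = G₀ '' fccStacking 1 (Real.sqrt (2 / 3)) →
      (fun q => B q + t) '' fccStacking 1 (Real.sqrt (2 / 3)) =
        (fun q => G₀ q + t) '' fccStacking 1 (Real.sqrt (2 / 3)) := by
    intro B t hB
    have e2 : (fun q => B q + t) '' fccStacking 1 (Real.sqrt (2 / 3)) =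
        (fun y => y + t) '' (B '' fccStacking 1 (Real.sqrt (2 / 3))) := by rw [Set.image_image]
    have e1 : (fun q => G₀ q + t) '' fccStacking 1 (Real.sqrt (2 / 3)) =
        (fun y => y + t) '' (G₀ '' fccStacking 1 (Real.sqrt (2 / 3))) := by rw [Set.image_image]
    rw [e2, e1, hB]
  have hΛ₁ := himg A₁ t₁ hG₀.symm
  have hΛ₂ := himg A₂ t₂ (htrans.symm.trans hG₀.symm)
  -- the partners as a function
  choose! sk hskS hsk0 hskew using hpart
  have hsk : ∀ r ∈ RT, sk r ∈ fccSlots ∧ ⟪r, sk r⟫_ℝ = 0 ∧ ∀ z : ℤ, ⟪G₀.symm (t₂ - t₁), sk r⟫_ℝ ≠ (z : ℝ) / 2 :=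
    fun r hr => ⟨hskS r hr, hsk0 r hr, hskew r hr⟩
  set K : ℝ := 12 * (12 * Real.sqrt 2 * Real.pi + 36 * 10 + 55440) with hK
  have hK0 : 0 ≤ K := by positivity
  obtain ⟨C, hC⟩ := twoSlab_cross_le_of_deficit A₁ t₁ A₂ t₂ 10 le_rfl
  have hK24 : 24 * (12 * Real.sqrt 2 * Real.pi + 36 * 10 + 55440) = 2 * K := by rw [hK]; ring
  refine ⟨C + 2 * K / sF / 2, 10, by norm_num, ?_⟩
  intro h hh ρ hρ X P₁ P₂ hX hP₁X hP₂X₁ hcyl hP₁ hP₂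
  have hP₂X : P₂ ⊆ X := hP₂X₁.trans sdiff_subset
  have hρ0 : (0 : ℝ) ≤ ρ := by linarith
  have hP₁' : ∀ p, p ∈ P₁ ↔ (p ∈ (fun q => G₀ q + t₁) '' fccStacking 1 (Real.sqrt (2 / 3)) ∧
      -(2 * 10) ≤ p 2 ∧ p 2 ≤ -10 ∧ p 0 ^ 2 + p 1 ^ 2 ≤ ρ ^ 2) := by
    intro p; rw [hP₁, hΛ₁]
  have hP₂' : ∀ p, p ∈ P₂ ↔ (p ∈ (fun q => G₀ q + t₂) '' fccStacking 1 (Real.sqrt (2 / 3)) ∧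
      h + 10 ≤ p 2 ∧ p 2 ≤ h + 2 * 10 ∧ p 0 ^ 2 + p 1 ^ 2 ≤ ρ ^ 2) := by
    intro p; rw [hP₂, hΛ₂]
  have hcell := wordNet_trans_payers_ge_plane_rowA ver hg hc G₀
    (F := fun κ => κ.foldr (fun μ G => ((ℝ ∙ μ)ᗮ.reflection).trans G) G₀) rfl (fun _ _ => rfl)
    RT hRT sk t₁ t₂ hsk hrow X P₁ P₂ 10 h ρ le_rfl hh hρ hX hcyl hP₁X hP₂X hP₁' hP₂'
  rw [hK24] at hcell
  -- the window's pooled deficiency dominates the payers' part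
  set W := X.filter (fun z => -(10 : ℝ) - 2 ≤ z 2 ∧ z 2 ≤ h + 10 + 2) with hW
  have hdef0 : ∀ z ∈ X, (0 : ℝ) ≤ 12 - ((X.filter fun q => dist z q = 1).card : ℝ) := by
    intro z _
    have := card_filter_dist_eq_one_le_twelve X hX z
    have : ((X.filter fun q => dist z q = 1).card : ℝ) ≤ 12 := by exact_mod_cast this
    linarith
  have hPW : ∑ z ∈ X.filter (fun z => (X.filter fun q => dist z q = 1).card ≤ 11 ∧
        -(10 : ℝ) - 2 ≤ z 2 ∧ z 2 ≤ h + 10 + 2), ((12 : ℝ) - ((X.filter fun q => dist z q = 1).card : ℝ)) ≤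
      ∑ z ∈ W, ((12 : ℝ) - ((X.filter fun q => dist z q = 1).card : ℝ)) :=
    sum_le_sum_of_subset_of_nonneg (fun z hz => by
        obtain ⟨hzX, -, h1, h2⟩ := mem_filter.1 hz
        exact mem_filter.2 ⟨hzX, h1, h2⟩)
      fun z hz _ => hdef0 z (mem_filter.1 hz).1
  have hpay : 2 * Real.sqrt 2 * Φ / sF * Real.pi * ρ ^ 2 - 2 * K / sF * (1 + h) * ρ ≤
      ∑ z ∈ W, ((12 : ℝ) - ((X.filter fun q => dist z q = 1).card : ℝ)) := by
    have hKh : 2 * K * ρ ≤ 2 * K * (1 + h) * ρ := by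
      have := mul_nonneg (mul_nonneg hK0 hh) hρ0; linarith only [this]
    have hπρ : 0 ≤ Real.pi * ρ ^ 2 := by positivity
    have hfl : Real.sqrt 2 * Φ * (Real.pi * ρ ^ 2) ≤ Real.sqrt 2 * (∑ r ∈ RT, (G₀ r) 2) * (Real.pi * ρ ^ 2) :=
      mul_le_mul_of_nonneg_right (mul_le_mul_of_nonneg_left hΦ (Real.sqrt_nonneg _)) hπρ
    have e : 2 * Real.sqrt 2 * Φ / sF * Real.pi * ρ ^ 2 - 2 * K / sF * (1 + h) * ρ =
        (2 * (Real.sqrt 2 * Φ * (Real.pi * ρ ^ 2)) - 2 * K * (1 + h) * ρ) / sF := by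
      field_simp
    rw [e, div_le_iff₀ hsF]
    have e2 : Real.sqrt 2 * (∑ r ∈ RT, (G₀ r) 2) * Real.pi * ρ ^ 2 =
        Real.sqrt 2 * (∑ r ∈ RT, (G₀ r) 2) * (Real.pi * ρ ^ 2) := by ring
    rw [e2] at hcell
    have hsW := mul_le_mul_of_nonneg_left hPW hsF.le
    linarith only [hcell, hKh, hfl, hsW]
  have key := hC h hh ρ hρ X P₁ P₂ hX hP₁X hP₂X₁ hcyl hP₁ hP₂ (2 * Real.sqrt 2 * Φ / sF) (2 * K / sF)
    (by positivity) hpay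
  have e : (2 * Real.sqrt 2 * Φ / sF : ℝ) / 2 = Real.sqrt 2 * Φ / sF := by ring
  rw [e] at key
  exact key

open scoped Classical in
/-- **Case (C) UNDER THE ROW: translation pairs whose offset is skew to every slot off a `{111}` plane of the
defender's frame `L'`**, the local row for `(⟨L', rising in-plane roots⟩, ⟨L', falling in-plane roots⟩)` with constant
`s_F`: charge `(√6/s_F)·sin θ'`.  See the module docstring. -/
theorem coaxialTwoSlabAdhesion_trans_skew_rowA
    (A₁ : EuclideanSpace ℝ (Fin 3) ≃ₗᵢ[ℝ] EuclideanSpace ℝ (Fin 3)) (t₁ : EuclideanSpace ℝ (Fin 3))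
    (A₂ : EuclideanSpace ℝ (Fin 3) ≃ₗᵢ[ℝ] EuclideanSpace ℝ (Fin 3)) (t₂ : EuclideanSpace ℝ (Fin 3))
    (L' : EuclideanSpace ℝ (Fin 3) ≃ₗᵢ[ℝ] EuclideanSpace ℝ (Fin 3))
    (hL' : L' '' fccStacking 1 (Real.sqrt (2 / 3)) = A₁ '' fccStacking 1 (Real.sqrt (2 / 3)))
    (htrans : A₁ '' fccStacking 1 (Real.sqrt (2 / 3)) = A₂ '' fccStacking 1 (Real.sqrt (2 / 3)))
    (hskew : ∀ s ∈ fccSlots, ⟪A₁ s, L' (EuclideanSpace.single (2 : Fin 3) (1 : ℝ))⟫_ℝ ≠ 0 →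
      ∀ z : ℤ, ⟪A₁.symm (t₂ - t₁), s⟫_ℝ ≠ (z : ℝ) / 2) {sF : ℝ} (hsF : 0 < sF)
    (hrow : LocalEndRowA ver sF ⟨L', inPlaneRoots L' 1⟩ ⟨L', inPlaneRoots L' (-1)⟩) :
    ∃ C R₀ : ℝ, 1 ≤ R₀ ∧ ∀ h : ℝ, 0 ≤ h → ∀ ρ : ℝ, R₀ ≤ ρ →
      ∀ X P₁ P₂ : Finset (EuclideanSpace ℝ (Fin 3)),
      (∀ p ∈ X, ∀ q ∈ X, p ≠ q → 1 ≤ dist p q) → P₁ ⊆ X → P₂ ⊆ X \ P₁ →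
      (∀ p ∈ X, -(2 * R₀) ≤ p 2 ∧ p 2 ≤ h + 2 * R₀ ∧ p 0 ^ 2 + p 1 ^ 2 ≤ ρ ^ 2) →
      (∀ p, p ∈ P₁ ↔ (p ∈ (fun q => A₁ q + t₁) '' fccStacking 1 (Real.sqrt (2 / 3)) ∧
        -(2 * R₀) ≤ p 2 ∧ p 2 ≤ -R₀ ∧ p 0 ^ 2 + p 1 ^ 2 ≤ ρ ^ 2)) →
      (∀ p, p ∈ P₂ ↔ (p ∈ (fun q => A₂ q + t₂) '' fccStacking 1 (Real.sqrt (2 / 3)) ∧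
        h + R₀ ≤ p 2 ∧ p 2 ≤ h + 2 * R₀ ∧ p 0 ^ 2 + p 1 ^ 2 ≤ ρ ^ 2)) →
      ((((P₁ ×ˢ (X \ P₁)).filter fun pq => dist pq.1 pq.2 = 1).card : ℕ) : ℝ) +
        ((((P₂ ×ˢ ((X \ P₁) \ P₂)).filter fun pq => dist pq.1 pq.2 = 1).card : ℕ) : ℝ) ≤
        contactDeficiency ((X \ P₁) \ P₂) +
          (Real.sqrt 2 / 4 * ∑ᶠ w ∈ {w ∈ fccStacking 1 (Real.sqrt (2 / 3)) | ‖w‖ = 1},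
              |⟪w, A₁.symm (EuclideanSpace.single (2 : Fin 3) (1 : ℝ))⟫_ℝ| +
            Real.sqrt 2 / 4 * ∑ᶠ w ∈ {w ∈ fccStacking 1 (Real.sqrt (2 / 3)) | ‖w‖ = 1},
              |⟪w, A₂.symm (EuclideanSpace.single (2 : Fin 3) (1 : ℝ))⟫_ℝ| -
            (Real.sqrt 6 / sF) * Real.sqrt (1 - ⟪L' (EuclideanSpace.single (2 : Fin 3) (1 : ℝ)),
              (EuclideanSpace.single (2 : Fin 3) (1 : ℝ))⟫_ℝ ^ 2)) * Real.pi * ρ ^ 2 +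
          C * (1 + h) * ρ := by
  set e₃ : EuclideanSpace ℝ (Fin 3) := EuclideanSpace.single (2 : Fin 3) (1 : ℝ) with he₃
  have he₃1 : ‖e₃‖ = 1 := by rw [he₃, PiLp.norm_single, norm_one]
  have hn1 : ‖L' e₃‖ = 1 := by rw [LinearIsometryEquiv.norm_map, he₃1]
  have hax : ∀ w : EuclideanSpace ℝ (Fin 3), ⟪L' w, L' e₃⟫_ℝ = w 2 := by
    intro w; rw [LinearIsometryEquiv.inner_map_map, apply_two_eq_inner_e₃]
  have hmenu : ∀ w ∈ fccSlots,
      ⟪L' w, L' e₃⟫_ℝ = 0 ∨ ⟪L' w, L' e₃⟫_ℝ = Real.sqrt (2 / 3) ∨ ⟪L' w, L' e₃⟫_ℝ = -Real.sqrt (2 / 3) := by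
    intro w hw; rw [hax]; exact slot_apply_two_cases hw
  -- the three rising in-plane roots and their (off-plane, hence skew) partners
  set RT := fccSlots.filter (fun r => ⟪L' r, L' e₃⟫_ℝ = 0 ∧ 0 < (L' r) 2) with hRTdef
  have hRT : ∀ r ∈ RT, r ∈ fccSlots ∧ 0 < (L' r) 2 := fun r hr =>
    ⟨(mem_filter.1 hr).1, (mem_filter.1 hr).2.2⟩
  have hpart : ∀ r ∈ RT, ∃ s ∈ fccSlots, ⟪r, s⟫_ℝ = 0 ∧ ∀ z : ℤ, ⟪L'.symm (t₂ - t₁), s⟫_ℝ ≠ (z : ℝ) / 2 := by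
    intro r hr
    obtain ⟨hrS, hr0, -⟩ := mem_filter.1 hr
    obtain ⟨s', hs', hrs'⟩ := exists_orth_slot hrS
    -- `s'` is off the plane
    have hs'0 : ⟪L' s', L' e₃⟫_ℝ ≠ 0 := fun h0 => inner_inPlane_slots_ne_zero L' hn1 hmenu hrS hs' hr0 h0 hrs'
    -- read `s'` in the frame `A₁`: `s := A₁⁻¹ (L' s')` is a slot with the same pairing
    have hmem : L' s' ∈ A₁ '' fccStacking 1 (Real.sqrt (2 / 3)) := by
      rw [← hL']; exact ⟨s', mem_fcc_of_mem_fccSlots hs', rfl⟩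
    obtain ⟨x, hx, hxs⟩ := hmem
    have hxs' : x = A₁.symm (L' s') := by rw [← hxs, LinearIsometryEquiv.symm_apply_apply]
    have hxS : x ∈ fccSlots := mem_fccSlots_of_unit hx (by
      rw [hxs', LinearIsometryEquiv.norm_map, LinearIsometryEquiv.norm_map, norm_eq_one_of_mem_fccSlots hs'])
    have hxax : ⟪A₁ x, L' e₃⟫_ℝ ≠ 0 := by rw [hxs]; exact hs'0
    refine ⟨s', hs', hrs', fun z hz => hskew x hxS hxax z ?_⟩
    rw [hxs', LinearIsometryEquiv.inner_map_map, ← hz]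
    conv_rhs => rw [← L'.inner_map_map, LinearIsometryEquiv.apply_symm_apply]
  -- the flux of the three in-plane classes
  have hflux : Real.sqrt 3 * Real.sqrt (1 - ⟪L' e₃, e₃⟫_ℝ ^ 2) ≤ ∑ r ∈ RT, (L' r) 2 :=
    sum_inPlane_rising_ge L' (fun b => cond b (((ℝ ∙ e₃).reflection).trans L') L') (Or.inl ⟨rfl, rfl⟩)
      (n := L' e₃) (Or.inl rfl)
  -- the row's root sets are `RT` and `−RT`
  have hRTeq : (⟨L', inPlaneRoots L' 1⟩ : PlateSystem) = ⟨L', RT⟩ := by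
    have : inPlaneRoots L' 1 = RT := by
      refine filter_congr fun r _ => ?_
      rw [hax, one_mul]
    rw [this]
  have hRTneg : (⟨L', inPlaneRoots L' (-1)⟩ : PlateSystem) = ⟨L', RT.image (fun r : EuclideanSpace ℝ (Fin 3) => -r)⟩ := by
    have : inPlaneRoots L' (-1) = RT.image (fun r : EuclideanSpace ℝ (Fin 3) => -r) := by
      ext r
      rw [inPlaneRoots, mem_filter, mem_image]
      constructor
      · rintro ⟨hrS, hr0, hrup⟩
        refine ⟨-r, mem_filter.2 ⟨neg_mem_fccSlots hrS, ?_, ?_⟩, neg_neg r⟩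
        · rw [hax, PiLp.neg_apply, hr0, neg_zero]
        · rw [map_neg, PiLp.neg_apply]; linarith
      · rintro ⟨r', hr', rfl⟩
        obtain ⟨hr'S, hr'0, hr'up⟩ := mem_filter.1 hr'
        rw [hax] at hr'0
        refine ⟨neg_mem_fccSlots hr'S, by rw [PiLp.neg_apply, hr'0, neg_zero], ?_⟩
        rw [map_neg, PiLp.neg_apply]; linarith
    rw [this]
  rw [hRTeq, hRTneg] at hrow
  obtain ⟨C, R₀, hR₀, hmain⟩ := translate_twoSlabAdhesion_roots_rowA ver hg hc A₁ t₁ A₂ t₂ htrans L' hL' RT hRT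
    hpart hflux hsF hrow
  refine ⟨C, R₀, hR₀, ?_⟩
  intro h hh ρ hρ X P₁ P₂ hX hP₁X hP₂X₁ hcyl hP₁ hP₂
  have key := hmain h hh ρ hρ X P₁ P₂ hX hP₁X hP₂X₁ hcyl hP₁ hP₂
  have e : Real.sqrt 2 * (Real.sqrt 3 * Real.sqrt (1 - ⟪L' e₃, e₃⟫_ℝ ^ 2)) / sF =
      Real.sqrt 6 / sF * Real.sqrt (1 - ⟪L' e₃, e₃⟫_ℝ ^ 2) := by
    rw [show (6 : ℝ) = 2 * 3 by norm_num, Real.sqrt_mul (by norm_num : (0 : ℝ) ≤ 2)]; ring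
  rw [e] at key
  exact key

open scoped Classical in
/-- **Case (B) UNDER THE ROW: translation pairs with a doubly skew cubic axis**, all four axis roots and the defender's
re-picked axis `L'` (`exists_axisRoots_sine`), the local row for EVERY rising root family of the frame `A₁` (implied by
the all-roots row) with constant `s_F`: charge `(√6/s_F)·sin θ'`.  See the module docstring. -/
theorem translate_twoSlabAdhesion_axis_rowA
    (A₁ : EuclideanSpace ℝ (Fin 3) ≃ₗᵢ[ℝ] EuclideanSpace ℝ (Fin 3)) (t₁ : EuclideanSpace ℝ (Fin 3))
    (A₂ : EuclideanSpace ℝ (Fin 3) ≃ₗᵢ[ℝ] EuclideanSpace ℝ (Fin 3)) (t₂ : EuclideanSpace ℝ (Fin 3))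
    (htrans : A₁ '' fccStacking 1 (Real.sqrt (2 / 3)) = A₂ '' fccStacking 1 (Real.sqrt (2 / 3)))
    (k : Fin 3)
    (hk : ∀ i : Fin 3, i ≠ k →
      (¬ ∃ z : ℤ, Real.sqrt 2 * cubicCoords (A₁.symm (t₂ - t₁)) k +
          Real.sqrt 2 * cubicCoords (A₁.symm (t₂ - t₁)) i = z) ∧
      (¬ ∃ z : ℤ, Real.sqrt 2 * cubicCoords (A₁.symm (t₂ - t₁)) k -
          Real.sqrt 2 * cubicCoords (A₁.symm (t₂ - t₁)) i = z)) {sF : ℝ} (hsF : 0 < sF)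
    (hrow : ∀ RT : Finset (EuclideanSpace ℝ (Fin 3)), (∀ r ∈ RT, r ∈ fccSlots ∧ 0 < (A₁ r) 2) →
      LocalEndRowA ver sF ⟨A₁, RT⟩ ⟨A₁, RT.image (fun r : EuclideanSpace ℝ (Fin 3) => -r)⟩) :
    ∃ L' : EuclideanSpace ℝ (Fin 3) ≃ₗᵢ[ℝ] EuclideanSpace ℝ (Fin 3),
      L' '' fccStacking 1 (Real.sqrt (2 / 3)) = A₁ '' fccStacking 1 (Real.sqrt (2 / 3)) ∧
    ∃ C R₀ : ℝ, 1 ≤ R₀ ∧ ∀ h : ℝ, 0 ≤ h → ∀ ρ : ℝ, R₀ ≤ ρ →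
      ∀ X P₁ P₂ : Finset (EuclideanSpace ℝ (Fin 3)),
      (∀ p ∈ X, ∀ q ∈ X, p ≠ q → 1 ≤ dist p q) → P₁ ⊆ X → P₂ ⊆ X \ P₁ →
      (∀ p ∈ X, -(2 * R₀) ≤ p 2 ∧ p 2 ≤ h + 2 * R₀ ∧ p 0 ^ 2 + p 1 ^ 2 ≤ ρ ^ 2) →
      (∀ p, p ∈ P₁ ↔ (p ∈ (fun q => A₁ q + t₁) '' fccStacking 1 (Real.sqrt (2 / 3)) ∧
        -(2 * R₀) ≤ p 2 ∧ p 2 ≤ -R₀ ∧ p 0 ^ 2 + p 1 ^ 2 ≤ ρ ^ 2)) →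
      (∀ p, p ∈ P₂ ↔ (p ∈ (fun q => A₂ q + t₂) '' fccStacking 1 (Real.sqrt (2 / 3)) ∧
        h + R₀ ≤ p 2 ∧ p 2 ≤ h + 2 * R₀ ∧ p 0 ^ 2 + p 1 ^ 2 ≤ ρ ^ 2)) →
      ((((P₁ ×ˢ (X \ P₁)).filter fun pq => dist pq.1 pq.2 = 1).card : ℕ) : ℝ) +
        ((((P₂ ×ˢ ((X \ P₁) \ P₂)).filter fun pq => dist pq.1 pq.2 = 1).card : ℕ) : ℝ) ≤
        contactDeficiency ((X \ P₁) \ P₂) +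
          (Real.sqrt 2 / 4 * ∑ᶠ w ∈ {w ∈ fccStacking 1 (Real.sqrt (2 / 3)) | ‖w‖ = 1},
              |⟪w, A₁.symm (EuclideanSpace.single (2 : Fin 3) (1 : ℝ))⟫_ℝ| +
            Real.sqrt 2 / 4 * ∑ᶠ w ∈ {w ∈ fccStacking 1 (Real.sqrt (2 / 3)) | ‖w‖ = 1},
              |⟪w, A₂.symm (EuclideanSpace.single (2 : Fin 3) (1 : ℝ))⟫_ℝ| -
            (Real.sqrt 6 / sF) * Real.sqrt (1 - ⟪L' (EuclideanSpace.single (2 : Fin 3) (1 : ℝ)),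
              (EuclideanSpace.single (2 : Fin 3) (1 : ℝ))⟫_ℝ ^ 2)) * Real.pi * ρ ^ 2 +
          C * (1 + h) * ρ := by
  set e₃ : EuclideanSpace ℝ (Fin 3) := EuclideanSpace.single (2 : Fin 3) (1 : ℝ) with he₃
  obtain ⟨RT, hRT, hpart, L', hL', hflux⟩ := exists_axisRoots_sine (A₁.symm (t₂ - t₁)) k hk A₁
  obtain ⟨C, R₀, hR₀, hmain⟩ := translate_twoSlabAdhesion_roots_rowA ver hg hc A₁ t₁ A₂ t₂ htrans A₁ rfl RT hRT
    hpart hflux hsF (hrow RT hRT)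
  refine ⟨L', hL', C, R₀, hR₀, ?_⟩
  intro h hh ρ hρ X P₁ P₂ hX hP₁X hP₂X₁ hcyl hP₁ hP₂
  have key := hmain h hh ρ hρ X P₁ P₂ hX hP₁X hP₂X₁ hcyl hP₁ hP₂
  have e : Real.sqrt 2 * (Real.sqrt 3 * Real.sqrt (1 - ⟪L' e₃, e₃⟫_ℝ ^ 2)) / sF =
      Real.sqrt 6 / sF * Real.sqrt (1 - ⟪L' e₃, e₃⟫_ℝ ^ 2) := by
    rw [show (6 : ℝ) = 2 * 3 by norm_num, Real.sqrt_mul (by norm_num : (0 : ℝ) ≤ 2)]; ring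
  rw [e] at key
  exact key

end Row

end Summit.Ventures.Crystal3D.Theorems

end
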